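import Mathlib
import HarnessLib
import Summits.NavierStokesRegularity.NavierStokesRegularity.Theorems.TypeIQuarterGateScarEnvelopeTypeIForcedTsaiAlgSoundF
import Summits.NavierStokesRegularity.NavierStokesRegularity.Theorems.TypeIQuarterGateScarEnvelopeTypeIForcedTsaiAlgWitnessMLF16
import Summits.NavierStokesRegularity.NavierStokesRegularity.Theorems.TypeIQuarterGateScarEnvelopeTypeIForcedTsaiAlgWitnessMLF8
import Summits.NavierStokesRegularity.NavierStokesRegularity.Theorems.TypeIQuarterGateScarEnvelopeTypeIForcedTsaiAlgWitnessMLF4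

/-!
# ARM B lane E-exact — multi-ℓ (swirl) Type-I rows with the certified floor AS TREE THEOREMS: ForcedTsaiModulusLE 16 308.721 (δ/M = 19.30), 8 139.764 (17.47), 4 64.961 (16.24)

Closers of kernel-checked LANEX-ALG v2 rows (Type-I-tail witnesses with exact far-field closure and the CERTIFIED
POLYNOMIAL LEVEL FLOOR `floorCertT3K30`) through `AlgRowF.sound` (`…ForcedTsaiAlgSoundF`): certified UPPER bounds on the
forced-Tsai modulus in the tree currency (`ℝ³`, weight `(1+ρ)⁵`, level on `B₁₀`):
`δ*(16) ≤ 308.7` (δ/M = 19.30); `δ*(8) ≤ 139.8` (δ/M = 17.47); `δ*(4) ≤ 64.96` (δ/M = 16.24).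
«Near-profiles this good EXIST»; UPPER bounds only; excludes nothing; nothing about NS regularity; 23843 / H3 OPEN.
-/

set_option linter.dupNamespace false

namespace Summit.NavierStokesRegularity.NavierStokesRegularity.Cruxes.ScarEnvelopeTypeI.ForcedTsai

/-- `δ*(16) ≤ 308721/1000` ≈ 308.7210 (Type-I-tail class, exact closure, certified polynomial floor; δ/M = 19.30). -/
theorem forcedTsaiModulusLE_algF_ML_16 : ForcedTsaiModulusLE (16 : ℝ) (308721 / 1000 : ℝ) := by
  have h := algRowFMLF16r0.sound algRowFMLF16r0_checkF
  norm_num [algRowFMLF16r0] at h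
  exact h

/-- `δ*(8) ≤ 34941/250` ≈ 139.7640 (Type-I-tail class, exact closure, certified polynomial floor; δ/M = 17.47). -/
theorem forcedTsaiModulusLE_algF_ML_8 : ForcedTsaiModulusLE (8 : ℝ) (34941 / 250 : ℝ) := by
  have h := algRowFMLF8r0.sound algRowFMLF8r0_checkF
  norm_num [algRowFMLF8r0] at h
  exact h

/-- `δ*(4) ≤ 64961/1000` ≈ 64.9610 (Type-I-tail class, exact closure, certified polynomial floor; δ/M = 16.24). -/
theorem forcedTsaiModulusLE_algF_ML_4 : ForcedTsaiModulusLE (4 : ℝ) (64961 / 1000 : ℝ) := by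
  have h := algRowFMLF4r0.sound algRowFMLF4r0_checkF
  norm_num [algRowFMLF4r0] at h
  exact h

/-- Rounded: `ForcedTsaiModulusLE 16 309` (`δ/M ≤ 19.32` at level 16, Type-I-tail class; cf. `…_16_642` Gaussian class,
`…_16_324` v1 floor). -/
theorem forcedTsaiModulusLE_16_309 : ForcedTsaiModulusLE (16 : ℝ) (309 : ℝ) :=
  forcedTsaiModulusLE_algF_ML_16.mono le_rfl (by norm_num)

end Summit.NavierStokesRegularity.NavierStokesRegularity.Cruxes.ScarEnvelopeTypeI.ForcedTsai
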